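import Literature.Topology.FourManifolds.StabilisationIntersectionForm
import Literature.Topology.FourManifolds.IntersectionLatticeProofs
import HarnessLib

/-!
# Wall's theorem on diffeomorphisms of `N # S² × S²` for `Q_N` even of signature zero,
# relative to the realisation of Kirby's generators (assembly of `Θ : Q_N ⊥ H ≅ Q_M`)

Topic `Literature/Topology/FourManifolds`; sibling proof file of `WallDiffeomorphisms.lean` (named
fact `exists_diffeomorph_freeCohomologyMap_eq_of_isometryEquiv` = R. Kirby, *The topology of
4-manifolds*, LNM 1374 (1989), Ch. X, Thm. 2 = C. T. C. Wall, *Diffeomorphisms of 4-manifolds*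
(1964), Thm. 2). `WallDiffeomorphismsGeneration.lean` proves the conclusion of Thm. X.2 for a
`ℤ`-oriented `(M, μ)` GIVEN an isometry `Θ : Q ⊕ H ≅ Q⟦μ⟧` from a symmetric unimodular even
form `Q` of signature `0` on an abstract lattice `V` (`ℤ`-module structure
`AddCommGroup.toIntModule`, the convention of the `LatticeForms*` files) and the realisation of the
transported Kirby generators `Θ s Θ⁻¹`; `StabilisationIntersectionForm.lean` proves Kirby's
Fig. 2a, `Q_{N # S² × S²} ≅ Q_N ⊥ H`, as an additive equivalence with the form identity (the
intersection forms of the tree live on the `ModuleCat` carriers `H²(·; ℤ)/T`, whose registered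
`ℤ`-module structure is not the canonical one, so that `Q⟦ν⟧.prod hyperbolicForm` has no
well-typed isometries in Mathlib's `LinearMap.BilinForm.IsometryEquiv`). This file supplies the
(purely formal) dictionary between the two conventions and assembles:

* `CohomologyLattice X k` — the lattice `Hᵏ(X; ℤ)/T` as a bare additive group (a type synonym of
  the carrier of `freeCohomology ℤ X k` whose only `ℤ`-module structure is the canonical one),
  with `CohomologyLattice.latticeForm Q` — a `ℤ`-bilinear form of the carrier read on the synonym
  (same values, `latticeForm_apply`) — and the transfer of symmetry, parity, unimodularity,
  signature, finiteness and freeness (all `ℤ`-module structures on an abelian group coincide,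
  `Subsingleton (Module ℤ ·)`).
* `exists_isometryEquiv_latticeForm_prod_hyperbolicForm_of_isConnectedSum` — **Kirby's Fig. 2a as
  an isometry of lattices**: for `N` closed connected with `ℤ`-orientation `ν`, `M` closed with
  `IsConnectedSum (𝓡 4) (𝓡 4) ((𝓡 2).prod (𝓡 2)) N (𝕊² × 𝕊²) M` and `μ` a `ℤ`-orientation of `M`,
  there are `ν' ∈ {ν, -ν}` and `Θ : (latticeForm Q⟦ν'⟧) ⊥ H ≅ Q⟦μ⟧` (Kirby 1989, Ch. X p. 61,
  Fig. 2a; Ch. II §1).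
* `forall_isRealisedByDiffeomorph_of_isConnectedSum_of_signature_eq_zero` — **Thm. X.2 for `Q_N`
  even of signature zero, relative to (R)**: if `N` is closed, connected, with `Q⟦ν⟧` even of
  signature `0` (so `Q⟦ν⟧ ≅ b·H`: `#ᵇ S² × S²`, for instance), `M = N # S² × S²` as above, and for
  every such identification `Θ` every transported Kirby generator `Θ s Θ⁻¹`
  (`s ∈ wallGenerators`: `A_a`, `A'_a`, `1 ⊕ O(H)`) is realised by a diffeomorphism of `M`, then
  EVERY automorphism of `Q⟦μ⟧` is realised by a diffeomorphism of `M` — Kirby's proof of Thm. X.2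
  (pp. 61–62) with its algebraic half (G) (`forall_isWordIn_wallGenerators_of_signature_eq_zero`),
  its group-theoretic closure (S) (`WallDiffeomorphismsProofs.lean`) and the identification of the
  form (Fig. 2a) all PROVED, and only the handle-slide realisation (R) of the generators left as the
  hypothesis `hS`.

Everything here is proved; no named fact is introduced (D-0026) and no statement of the tree is
changed.

## References

* R. C. Kirby, *The topology of 4-manifolds*, LNM 1374 (1989), Ch. X, Thm. 2 (p. 59) and its proof
  (pp. 61–62, Fig. 2a); Ch. II §1. [Kirby1989]
* C. T. C. Wall, *Diffeomorphisms of 4-manifolds*, J. London Math. Soc. 39 (1964) 131–140, Thm. 2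
  and p. 136 (not held; cited after Kirby).
* J. Milnor, D. Husemoller, *Symmetric bilinear forms*, Springer (1973), §I.1–3, §V.1.
  [MilnorHusemoller1973]
-/

open scoped Manifold ContDiff
open Set Function
open Literature.AlgebraicTopology.SingularHomology
open LinearMap (BilinForm)

noncomputable section

namespace Literature.Topology.FourManifolds

/-- Local notation: `𝔼 n` is the model Euclidean space `EuclideanSpace ℝ (Fin n)`. -/
local notation "𝔼 " n:arg => EuclideanSpace ℝ (Fin n)

/-- Local notation: `𝕊 n` is the unit sphere in `EuclideanSpace ℝ (Fin (n + 1))`. -/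
local notation "𝕊 " n:arg => (Metric.sphere (0 : EuclideanSpace ℝ (Fin (n + 1))) 1)

/-- Local notation: `Q⟦μ⟧` is the intersection form
`Literature.AlgebraicTopology.SingularHomology.intersectionForm two_add_two_eq_four μ` on `H²(·; ℤ)/T`. -/
local notation "Q⟦" μ "⟧" =>
  Literature.AlgebraicTopology.SingularHomology.intersectionForm two_add_two_eq_four μ

/-! ### Transfer between `ℤ`-module structures on one abelian group -/

section Transfer

variable {V : Type*} [AddCommGroup V]

/-- Unimodularity of a `ℤ`-bilinear form does not depend on the `ℤ`-module structure used to state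
it (all `ℤ`-module structures on an abelian group coincide). [folklore] -/
theorem isUnimodular_iff_of_forall_eq (i₁ i₂ : Module ℤ V) (Q₁ : @BilinForm ℤ _ V _ i₁)
    (Q₂ : @BilinForm ℤ _ V _ i₂) (h : ∀ a b, Q₁ a b = Q₂ a b) :
    @LinearMap.BilinForm.IsUnimodular V _ i₁ Q₁ ↔ @LinearMap.BilinForm.IsUnimodular V _ i₂ Q₂ := by
  obtain rfl : i₁ = i₂ := Subsingleton.elim _ _
  obtain rfl : Q₁ = Q₂ := LinearMap.ext₂ h
  exact Iff.rfl

/-- The signature of a `ℤ`-bilinear form does not depend on the `ℤ`-module structure used to state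
it. [folklore] -/
theorem signature_eq_of_forall_eq (i₁ i₂ : Module ℤ V) (Q₁ : @BilinForm ℤ _ V _ i₁)
    (Q₂ : @BilinForm ℤ _ V _ i₂) (h : ∀ a b, Q₁ a b = Q₂ a b) :
    @LinearMap.BilinForm.signature V _ i₁ Q₁ = @LinearMap.BilinForm.signature V _ i₂ Q₂ := by
  obtain rfl : i₁ = i₂ := Subsingleton.elim _ _
  obtain rfl : Q₁ = Q₂ := LinearMap.ext₂ h
  rfl

/-- Finiteness over `ℤ` does not depend on the `ℤ`-module structure. [folklore] -/
theorem moduleFinite_of_moduleFinite (i₁ i₂ : Module ℤ V) (h : @Module.Finite ℤ V _ _ i₁) :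
    @Module.Finite ℤ V _ _ i₂ := by
  obtain rfl : i₁ = i₂ := Subsingleton.elim _ _
  exact h

/-- Freeness over `ℤ` does not depend on the `ℤ`-module structure. [folklore] -/
theorem moduleFree_of_moduleFree (i₁ i₂ : Module ℤ V) (h : @Module.Free ℤ V _ _ i₁) :
    @Module.Free ℤ V _ _ i₂ := by
  obtain rfl : i₁ = i₂ := Subsingleton.elim _ _
  exact h

end Transfer

/-! ### The cohomology lattice on its canonical `ℤ`-module structure -/

/-- **The lattice `Hᵏ(X; ℤ)/T` as a bare abelian group**: a type synonym of the carrier of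
`freeCohomology ℤ X k` carrying only its additive structure, so that its `ℤ`-module structure is
the canonical `AddCommGroup.toIntModule` — the convention of the abstract lattices of
`LatticeForms*.lean`, `wallGenerators` and `forall_isRealisedByDiffeomorph_of_forall_mem_wallGenerators`
(Milnor–Husemoller 1973, §I.1: a lattice is a free abelian group with a bilinear form). [cite: MilnorHusemoller1973, §I.1] -/
def CohomologyLattice (X : Type) [TopologicalSpace X] (k : ℕ) : Type :=
  ↥(freeCohomology ℤ X k)

namespace CohomologyLattice

variable {X : Type} [TopologicalSpace X] {k : ℕ}

/-- The additive group structure of the lattice synonym is that of `Hᵏ(X; ℤ)/T` (so its only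
`ℤ`-module structure is `AddCommGroup.toIntModule`). [folklore] -/
instance : AddCommGroup (CohomologyLattice X k) :=
  inferInstanceAs (AddCommGroup ↥(freeCohomology ℤ X k))

/-- The identification of `Hᵏ(X; ℤ)/T` with the lattice synonym (the identity). [folklore] -/
def of : ↥(freeCohomology ℤ X k) ≃+ CohomologyLattice X k := AddEquiv.refl _

/-- A `ℤ`-bilinear form of the `ModuleCat` carrier `Hᵏ(X; ℤ)/T` as a map into additive
homomorphisms of the lattice synonym (forgetting `ℤ`-linearity, which is automatic). [folklore] -/
def toAddMonoidHom₂ (Q : BilinForm ℤ ↥(freeCohomology ℤ X k)) :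
    CohomologyLattice X k →+ (CohomologyLattice X k →+ ℤ) where
  toFun a := ((Q (of.symm a)).toAddMonoidHom).comp of.symm.toAddMonoidHom
  map_zero' := by
    ext b
    simp
  map_add' a a' := by
    ext b
    simp

/-- **The form `Q` read on the lattice synonym**: the same function `(a, b) ↦ Q a b`, `ℤ`-bilinear
for the canonical `ℤ`-module structure. [cite: MilnorHusemoller1973, §I.1] -/
def latticeForm (Q : BilinForm ℤ ↥(freeCohomology ℤ X k)) : BilinForm ℤ (CohomologyLattice X k) :=
  (addMonoidHomLequivInt (A := CohomologyLattice X k) (B := ℤ) ℤ).toLinearMap ∘ₗ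
    (toAddMonoidHom₂ Q).toIntLinearMap

/-- `latticeForm Q a b = Q a b`. [folklore] -/
@[simp] theorem latticeForm_apply (Q : BilinForm ℤ ↥(freeCohomology ℤ X k))
    (a b : CohomologyLattice X k) : latticeForm Q a b = Q (of.symm a) (of.symm b) := rfl

/-- Symmetry transfers to the lattice synonym. [folklore] -/
theorem isSymm_latticeForm {Q : BilinForm ℤ ↥(freeCohomology ℤ X k)} (hQ : Q.IsSymm) :
    (latticeForm Q).IsSymm :=
  ⟨fun a b => by rw [latticeForm_apply, latticeForm_apply, hQ.eq]⟩

/-- Parity transfers to the lattice synonym. [folklore] -/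
theorem isEven_latticeForm {Q : BilinForm ℤ ↥(freeCohomology ℤ X k)} (hQ : Q.IsEven) :
    (latticeForm Q).IsEven := fun a => by
  rw [latticeForm_apply]
  exact hQ _

/-- Unimodularity transfers to the lattice synonym. [folklore] -/
theorem isUnimodular_latticeForm {Q : BilinForm ℤ ↥(freeCohomology ℤ X k)} (hQ : Q.IsUnimodular) :
    (latticeForm Q).IsUnimodular :=
  (isUnimodular_iff_of_forall_eq (V := CohomologyLattice X k) _ _ (latticeForm Q) Q
    (fun _ _ => rfl)).2 hQ

/-- The signature is unchanged on the lattice synonym. [folklore] -/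
theorem signature_latticeForm (Q : BilinForm ℤ ↥(freeCohomology ℤ X k)) :
    (latticeForm Q).signature = Q.signature :=
  signature_eq_of_forall_eq (V := CohomologyLattice X k) _ _ (latticeForm Q) Q (fun _ _ => rfl)

/-- For a closed topological manifold the lattice `Hᵏ(X; ℤ)/T` is finitely generated
(Hatcher 2002, Cor. A.8–A.9; the tree's `finite_freeCohomology`). [cite: HatcherAT2002, §3.3 p. 250 with Cor. A.8–A.9] -/
theorem moduleFinite {n : ℕ} [CompactSpace X] [T2Space X] [ChartedSpace (𝔼 n) X] :
    Module.Finite ℤ (CohomologyLattice X k) :=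
  moduleFinite_of_moduleFinite (V := CohomologyLattice X k) _ _
    (finite_freeCohomology (finite_singularCohomology_of_compactSpace_of_isPrincipalIdealRing ℤ X n k))

/-- For a closed topological manifold the lattice `Hᵏ(X; ℤ)/T` is free
(the tree's `free_freeCohomology`). [cite: HatcherAT2002, §3.3 p. 250 with Cor. A.8–A.9] -/
theorem moduleFree {n : ℕ} [CompactSpace X] [T2Space X] [ChartedSpace (𝔼 n) X] :
    Module.Free ℤ (CohomologyLattice X k) :=
  moduleFree_of_moduleFree (V := CohomologyLattice X k) _ _
    (free_freeCohomology (finite_singularCohomology_of_compactSpace_of_isPrincipalIdealRing ℤ X n k))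

end CohomologyLattice

open CohomologyLattice

/-! ### Kirby's Fig. 2a as an isometry of lattices -/

/-- **`Q_{N # S² × S²} ≅ Q_N ⊥ H` as an isometry of lattices** (Kirby 1989, Ch. X, proof of Thm. 2,
Fig. 2a; Ch. II §1): for `N` closed connected with a `ℤ`-orientation `ν`, `M` closed with
`IsConnectedSum (𝓡 4) (𝓡 4) ((𝓡 2).prod (𝓡 2)) N (𝕊² × 𝕊²) M` and any `ℤ`-orientation `μ` of `M`,
there are `ν' ∈ {ν, -ν}` and an isometry `Θ : (latticeForm Q⟦ν'⟧) ⊥ H ≅ Q⟦μ⟧` in Mathlib's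
`LinearMap.BilinForm.IsometryEquiv`, the shape of the hypothesis `Θ` of
`forall_isRealisedByDiffeomorph_of_forall_mem_wallGenerators` (from
`exists_addEquiv_intersectionForm_eq_of_isConnectedSum`; an additive bijection is `ℤ`-linear).
[cite: Kirby1989, Ch. X, proof of Thm. 2 (p. 61, Fig. 2a); Ch. II §1] -/
theorem exists_isometryEquiv_latticeForm_prod_hyperbolicForm_of_isConnectedSum
    (N : Type) [TopologicalSpace N] [T2Space N] [CompactSpace N] [ChartedSpace (𝔼 4) N]
    [ConnectedSpace N] (ν : HomologicalOrientation ℤ N 4)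
    (M : Type) [TopologicalSpace M] [T2Space M] [CompactSpace M] [ChartedSpace (𝔼 4) M]
    (hM : IsConnectedSum (𝓡 4) (𝓡 4) ((𝓡 2).prod (𝓡 2)) N ((𝕊 2) × (𝕊 2)) M)
    (μ : HomologicalOrientation ℤ M 4) :
    ∃ ν' : HomologicalOrientation ℤ N 4, (ν' = ν ∨ ν' = -ν) ∧
      Nonempty (((latticeForm (Q⟦ν'⟧)).prod hyperbolicForm).IsometryEquiv (Q⟦μ⟧)) := by
  obtain ⟨ν', hν', Θ, hΘ⟩ := exists_addEquiv_intersectionForm_eq_of_isConnectedSum N ν M hM μ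
  refine ⟨ν', hν', ⟨?_⟩⟩
  -- the additive bijection `(a, v) ↦ Θ (a, v)` read on the synonym, made `ℤ`-linear
  let E : (CohomologyLattice N 2 × (Fin 2 → ℤ)) ≃+ ↥(freeCohomology ℤ M 2) :=
    (AddEquiv.prodCongr (of (X := N) (k := 2)).symm (AddEquiv.refl _)).trans Θ
  have hE : ∀ x, E x = Θ (of.symm x.1, x.2) := fun x => rfl
  refine
    { toLinearEquiv := E.toLinearEquiv (fun c x => ?_)
      map_app' := fun x y => ?_ }
  · rw [map_zsmul]
    exact (int_smul_eq_zsmul _ c (E x)).symm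
  · change Q⟦μ⟧ (E x) (E y) = _
    rw [hE, hE, hΘ, LinearMap.BilinForm.prod_apply, latticeForm_apply]

/-! ### Thm. X.2 for `Q_N` even of signature zero, relative to the realisation of the generators -/

/-- **Wall's theorem on diffeomorphisms (Kirby 1989, Thm. X.2) for `Q_N` even of signature zero,
relative to the realisation (R) of Kirby's generators.** Let `N` be a closed connected 4-manifold
with a `ℤ`-orientation `ν` whose intersection form `Q⟦ν⟧` is even of signature `0`, `M` a closed
4-manifold which is a connected sum `N # (S² × S²)` (the relational
`IsConnectedSum (𝓡 4) (𝓡 4) ((𝓡 2).prod (𝓡 2)) N (𝕊² × 𝕊²) M` of the named fact), `μ` a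
`ℤ`-orientation of `M`. Suppose (R): for every orientation `ν'` of `N` and every isometry
`Θ : (latticeForm Q⟦ν'⟧) ⊥ H ≅ Q⟦μ⟧`, each transported Kirby generator `Θ s Θ⁻¹`,
`s ∈ wallGenerators` (the transvections `A_a`, `A'_a` — Kirby's handle slides, pp. 61–62 — and
`1 ⊕ O(H)` — "the automorphisms induced by diffeomorphisms of `S² × S²` connect sum the identity on
`N`"), is realised by a diffeomorphism of `M`. Then every automorphism of `Q⟦μ⟧` is realised by a
diffeomorphism of `M` (`IsRealisedByDiffeomorph`). Assembled from Fig. 2a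
(`exists_isometryEquiv_latticeForm_prod_hyperbolicForm_of_isConnectedSum`), Poincaré duality
(`isUnimodular_intersectionForm_holds`), the generation theorem for `Q ≅ b·H` and the closure of
realised automorphisms (`forall_isRealisedByDiffeomorph_of_forall_mem_wallGenerators`).
[cite: Kirby1989, Ch. X, Thm. 2 (p. 59) and its proof (pp. 61–62)] -/
theorem forall_isRealisedByDiffeomorph_of_isConnectedSum_of_signature_eq_zero
    (N : Type) [TopologicalSpace N] [T2Space N] [CompactSpace N] [ChartedSpace (𝔼 4) N]
    [ConnectedSpace N] (ν : HomologicalOrientation ℤ N 4)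
    (hev : (Q⟦ν⟧).IsEven) (hsig : (Q⟦ν⟧).signature = 0)
    (M : Type) [TopologicalSpace M] [T2Space M] [CompactSpace M] [ChartedSpace (𝔼 4) M]
    (hM : IsConnectedSum (𝓡 4) (𝓡 4) ((𝓡 2).prod (𝓡 2)) N ((𝕊 2) × (𝕊 2)) M)
    (μ : HomologicalOrientation ℤ M 4)
    (hS : ∀ (ν' : HomologicalOrientation ℤ N 4)
      (Θ : ((latticeForm (Q⟦ν'⟧)).prod hyperbolicForm).IsometryEquiv (Q⟦μ⟧)),
      ∀ s ∈ wallGenerators (isSymm_latticeForm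
        (isSymm_intersectionForm (cupProduct_gradedComm_holds ℤ N) even_two two_add_two_eq_four ν')),
        IsRealisedByDiffeomorph μ (Θ.symm.trans (s.trans Θ)))
    (A : (Q⟦μ⟧).IsometryEquiv (Q⟦μ⟧)) : IsRealisedByDiffeomorph μ A := by
  obtain ⟨ν', hν', ⟨Θ⟩⟩ :=
    exists_isometryEquiv_latticeForm_prod_hyperbolicForm_of_isConnectedSum N ν M hM μ
  haveI : Module.Finite ℤ (CohomologyLattice N 2) := CohomologyLattice.moduleFinite (n := 4)
  haveI : Module.Free ℤ (CohomologyLattice N 2) := CohomologyLattice.moduleFree (n := 4)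
  -- the hypotheses of the generation theorem for `latticeForm Q⟦ν'⟧`
  have hneg : Q⟦-ν⟧ = -Q⟦ν⟧ :=
    intersectionForm_neg (HomologicalOrientation.fundamentalClass_neg_holds ℤ N 4) two_add_two_eq_four ν
  have hev' : (Q⟦ν'⟧).IsEven := by
    rcases hν' with rfl | rfl
    · exact hev
    · intro x
      rw [hneg, LinearMap.neg_apply, LinearMap.neg_apply]
      exact (hev x).neg
  have hsig' : (Q⟦ν'⟧).signature = 0 := by
    rcases hν' with rfl | rfl
    · exact hsig
    · rw [hneg, LinearMap.BilinForm.signature_neg, hsig, neg_zero]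
  have hu' : (Q⟦ν'⟧).IsUnimodular :=
    isUnimodular_intersectionForm_holds (X := N) two_add_two_eq_four ν'
  exact forall_isRealisedByDiffeomorph_of_forall_mem_wallGenerators μ
    (isSymm_latticeForm
      (isSymm_intersectionForm (cupProduct_gradedComm_holds ℤ N) even_two two_add_two_eq_four ν'))
    (isUnimodular_latticeForm hu') (isEven_latticeForm hev')
    ((signature_latticeForm _).trans hsig') Θ (hS ν' Θ) A

end Literature.Topology.FourManifolds

end
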